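import Summits.BirchSwinnertonDyer.BirchSwinnertonDyer.Theorems.AlignedTransportAtTwoMainConjectureOfRankZeroBSDAtTwoHalfDescentLayerIndexGrowthFiniteTwistPlusMinus
import HarnessLib

/-!
# Route `AlignedTransportAtTwo`, crux C2 `MainConjectureOfRankZeroBSDAtTwo` (stmt-BirchSwinnertonDyer-22298):
# THE TWIST READING OF THE MINUS PART, V — THE PRODUCT FORMULA AND THE GROWTH NUMBER: on the seed cell `#Sel_{2^∞}(E/K_{n+1}) = #Sel♯_n(E) · #I_{n+1}`, hence
# `#Sel_{2^∞}(E/K_{n+1}) ∣ #Sel♯_n(E) · #Sel♯_n(E′)` and `#Sel♯_n(E) · #Sel♯_n(E′) ∣ #Sel_{2^∞}(E/K_{n+1}) · #M_{n+1}[2]` (Dokchitser–Dokchitser's Lemma 4.14 as an order formula on relaxed Selmer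
# groups one layer down, exact up to `M[2]`), and the growth number `g_n = #(ω_nX/ω_{n+1}X)` of `X(E/K_∞)` satisfies `g_n ∣ #Sel♯_n(E′) · #ker g_{n+1}`, `#Sel♯_n(E′) ∣ g_n · #M_{n+1}[2]`

HONEST FRAMING (cell `bsd-f1-sign2`, WIDTH-5 attached prover seat `bsd-line-att-p5` gen 58 on line `birth` of the lead `bsd-line-att-p2`;
`--supports` stmt-BirchSwinnertonDyer-22298, closes nothing; BSD is NOT proved by any of this; the crux C2, its verdict «blocked-on
`Rank1Residual.GreenbergMuConjectureIrreducible`» and every registered stub (P / T / Kμ / LimDoor / MuIneqʳ / PFμ⁺) are untouched). THEOREMS ONLY — no `def`,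
no instance, no named fact, no `sorry`. Sequel of `…GrowthFiniteTwist` (`#Sel_{n+1} = #Sel⁺·#I`), `…GrowthFiniteTwistPlusMinus` (`#Sel⁺_{n+1} = #Sel♯_n(E)`, `#M_{n+1}(E) = #Sel♯_n(E′)`,
`Sel♯_n := res⁻¹(Sel_{n+1})`), gen 57's `…GrowthFiniteTwo` (`#I ∣ #M ∣ #I·#M[2]`) and `…GrowthFiniteCell` (`#I_{n+1} ∣ g_n ∣ #I_{n+1}·#ker g_{n+1}` on the cell). Twisting datum
abstract (`Ψ`, any `n`); discharged at the first layer for `W.quadraticTwist d` (any `K`) and over `ℚ` (`ℚ_1 = ℚ(√2)`, `E^{(2)}`) as in `…GrowthFiniteTwistQuadratic`.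

* §1 ★★ `natCard_selmerLayer_succ_eq_natCard_comap_mul` (**`#Sel_{2^∞}(E/K_{n+1}) = #Sel♯_n(E) · #I_{n+1}`**, `E[2^∞]^{Gal(K̄/K_{n+1})} = 0`);
  ★★★ `natCard_selmerLayer_succ_dvd_natCard_comap_mul_comap` (**`#Sel(E/K_{n+1}) ∣ #Sel♯_n(E) · #Sel♯_n(E′)`**), ★★★ `natCard_comap_mul_comap_dvd` (**`#Sel♯_n(E)·#Sel♯_n(E′) ∣ #Sel(E/K_{n+1})·#M_{n+1}[2]`**);
  ★★ `growth_dvd_natCard_comap_mul_kerG_and_dvd` (**`g_n ∣ #Sel♯_n(E′)·#ker g_{n+1}`, `#Sel♯_n(E′) ∣ g_n·#M_{n+1}[2]`** on the seed cell) — the growth number of the Iwasawa module is the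
  relaxed `2^∞`-Selmer group of the twist one layer down, up to Greenberg's control kernel and the `2`-torsion of the minus part.
* §2 the first layer for `W.quadraticTwist d` (any `K`) and §3 `K = ℚ` cyclotomic: ★★★ **`#Sel_{2^∞}(E/ℚ(√2)) ∣ #Sel♯_0(E) · #Sel♯_0(E^{(2)})`**, **`#Sel♯_0(E)·#Sel♯_0(E^{(2)}) ∣ #Sel_{2^∞}(E/ℚ(√2))·#M_1[2]`**,
  **`g_0 ∣ #Sel♯_0(E^{(2)})·#ker g_1`**, **`#Sel♯_0(E^{(2)}) ∣ g_0·#M_1[2]`** for every elliptic `E/ℚ` without a rational `2`-torsion abscissa and every cyclotomic datum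
  (`Sel♯_0(·) = {η ∈ H¹(ℚ, ·[2^∞]) : res η ∈ Sel_{2^∞}(·/ℚ(√2))}` ⊇ `Sel_{2^∞}(·/ℚ)`, index killed by `2`).
What is NOT claimed: nothing numerical about any curve; no Selmer group computed; C2 untouched. Memo `Cruxes/MainConjectureOfRankZeroBSDAtTwo/TWIST-READING-att-p5-g58.md`.

References: T. Dokchitser, V. Dokchitser, Ann. of Math. 172 (2010), Lemma 4.14 (proof) [DokchitserDokchitserAnnals2010]; R. Greenberg, LNM 1716 (1999), §1 pp. 60–65, §3 Lemmas 3.1–3.3,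
§4 p. 107, Lemma 4.3 [GreenbergLNM1716]; B. Mazur, Invent. Math. 18 (1972) §6 [Mazur1972]; J.-P. Serre, *Galois Cohomology*, I.§2.4–2.6 [SerreGaloisCohomology1997]; L. Washington, GTM 83
§13.1 [Washington1997].
-/

set_option linter.dupNamespace false
set_option autoImplicit false

noncomputable section

open scoped Classical AddSubgroup Polynomial

universe u

namespace Summit.BirchSwinnertonDyer.BirchSwinnertonDyer.Theorems.AlignedTransportAtTwoHalfDescentLayerIndexGrowthFiniteTwistProduct

open WeierstrassCurve Literature.NumberTheory.EllipticCurves Literature.NumberTheory.EllipticCurves.IwasawaDual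
  Literature.NumberTheory.EllipticCurves.IwasawaAlgebra
  Literature.NumberTheory.EllipticCurves.Greenberg1999
  Summit.BirchSwinnertonDyer.Rank1Residual.X1.MuLambda
  Summit.BirchSwinnertonDyer.Rank1Residual.Iwasawa
  Summit.BirchSwinnertonDyer.BirchSwinnertonDyer.Theorems
  Summit.BirchSwinnertonDyer.BirchSwinnertonDyer.Theorems.AlignedTransportAtTwoHalfDescentLayerIndexGrowthFinite
  Summit.BirchSwinnertonDyer.BirchSwinnertonDyer.Theorems.AlignedTransportAtTwoHalfDescentLayerIndexGrowthFiniteTwo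
  Summit.BirchSwinnertonDyer.BirchSwinnertonDyer.Theorems.AlignedTransportAtTwoHalfDescentLayerIndexGrowthFiniteCell
  Summit.BirchSwinnertonDyer.BirchSwinnertonDyer.Theorems.AlignedTransportAtTwoHalfDescentLayerIndexGrowthFiniteTwist
  Summit.BirchSwinnertonDyer.BirchSwinnertonDyer.Theorems.AlignedTransportAtTwoHalfDescentLayerIndexGrowthFiniteTwistMinus
  Summit.BirchSwinnertonDyer.BirchSwinnertonDyer.Theorems.AlignedTransportAtTwoHalfDescentLayerIndexGrowthFiniteTwistQuadratic
  Summit.BirchSwinnertonDyer.BirchSwinnertonDyer.Theorems.AlignedTransportAtTwoHalfDescentLayerIndexGrowthFiniteTwistPlusMinus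

/-! ## §1 The product formula and the growth number (abstract twisting datum, any layer) -/

section Product

variable {K : Type u} [Field K] [NumberField K] (W W' : WeierstrassCurve K) (κ : ZpExtension K 2) {γ : Field.absoluteGaloisGroup K} (n : ℕ)
  (Ψ : W'.subgroupH1 2 (κ.layerSubgroup (n + 1)) ≃+ W.subgroupH1 2 (κ.layerSubgroup (n + 1)))

/-- ★★ **`#Sel_{2^∞}(E/K_{n+1}) = #Sel♯_n(E) · #I_{n+1}`** when `E[2^∞]^{Gal(K̄/K_{n+1})} = 0` (`#Sel_{n+1} = #Sel⁺·#I` and `#Sel⁺_{n+1} = #Sel♯_n`): the honest Selmer group over `K_{n+1}` is the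
relaxed Selmer group one layer down times gen 57's finite-level avatar of the growth number. [cite: GreenbergLNM1716, §3 Lemmas 3.1–3.3] [cite: SerreGaloisCohomology1997, I.§2.6 (b)] -/
theorem natCard_selmerLayer_succ_eq_natCard_comap_mul (hfix : FixedPoints.addSubgroup (κ.layerSubgroup (n + 1)) (W.geomPrimaryTorsion 2) = ⊥) (hγ : κ.IsTopGenerator γ) :
    Nat.card (W.selmerLayer κ (n + 1)) =
      Nat.card ↥((W.selmerLayer κ (n + 1)).comap (W.resOfLe 2 (κ.layerSubgroup_antitone (Nat.le_succ n)))) *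
        Nat.card ↥((W.selmerLayer κ (n + 1)).map (W.conjH1 2 (κ.layerSubgroup (n + 1)) (γ ^ 2 ^ n) - AddMonoidHom.id (W.subgroupH1 2 (κ.layerSubgroup (n + 1))))) := by
  rw [natCard_selmerLayer_succ_eq_mul W κ (γ := γ) n, natCard_inf_ker_sub_eq_natCard_comap W κ n hfix hγ]

/-- ★★★ **`#Sel_{2^∞}(E/K_{n+1}) ∣ #Sel♯_n(E) · #Sel♯_n(E′)`** (`E[2^∞]`, `E′[2^∞]` without non-zero `Gal(K̄/K_{n+1})`-fixed points; twisting datum `Ψ`): `#I ∣ #M = #Sel♯_n(E′)`.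
[cite: DokchitserDokchitserAnnals2010, Lemma 4.14 (proof)] [cite: GreenbergLNM1716, §4 p. 107] -/
theorem natCard_selmerLayer_succ_dvd_natCard_comap_mul_comap (hγ : κ.IsTopGenerator γ) (hΨsel : ∀ x, x ∈ W'.selmerLayer κ (n + 1) ↔ Ψ x ∈ W.selmerLayer κ (n + 1))
    (hΨg : ∀ x, Ψ (W'.conjH1 2 (κ.layerSubgroup (n + 1)) (γ ^ 2 ^ n) x) = -(W.conjH1 2 (κ.layerSubgroup (n + 1)) (γ ^ 2 ^ n) (Ψ x)))
    (hfix : FixedPoints.addSubgroup (κ.layerSubgroup (n + 1)) (W.geomPrimaryTorsion 2) = ⊥)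
    (hfix' : FixedPoints.addSubgroup (κ.layerSubgroup (n + 1)) (W'.geomPrimaryTorsion 2) = ⊥) :
    Nat.card (W.selmerLayer κ (n + 1)) ∣
      Nat.card ↥((W.selmerLayer κ (n + 1)).comap (W.resOfLe 2 (κ.layerSubgroup_antitone (Nat.le_succ n)))) *
        Nat.card ↥((W'.selmerLayer κ (n + 1)).comap (W'.resOfLe 2 (κ.layerSubgroup_antitone (Nat.le_succ n)))) := by
  rw [natCard_selmerLayer_succ_eq_natCard_comap_mul W κ n hfix hγ, ← natCard_normKer_eq_natCard_twist_comap W W' κ n Ψ hγ hΨsel hΨg hfix']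
  exact mul_dvd_mul_left _ (natCard_map_dvd_natCard_normKer W κ hγ n)

/-- ★★★ **`#Sel♯_n(E) · #Sel♯_n(E′) ∣ #Sel_{2^∞}(E/K_{n+1}) · #M_{n+1}[2]`** (same hypotheses): `#M ∣ #I·#M[2]`. Together with the previous theorem: Dokchitser–Dokchitser's
`Sel(E/K_{n+1}) ≈ Sel(E/K_n) ⊕ Sel(E′/K_n)` as an order formula on RELAXED Selmer groups, exact up to the `2`-torsion of the minus part. [cite: DokchitserDokchitserAnnals2010, Lemma 4.14 (proof)]
[cite: GreenbergLNM1716, §4 p. 107] -/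
theorem natCard_comap_mul_comap_dvd (hγ : κ.IsTopGenerator γ) (hΨsel : ∀ x, x ∈ W'.selmerLayer κ (n + 1) ↔ Ψ x ∈ W.selmerLayer κ (n + 1))
    (hΨg : ∀ x, Ψ (W'.conjH1 2 (κ.layerSubgroup (n + 1)) (γ ^ 2 ^ n) x) = -(W.conjH1 2 (κ.layerSubgroup (n + 1)) (γ ^ 2 ^ n) (Ψ x)))
    (hfix : FixedPoints.addSubgroup (κ.layerSubgroup (n + 1)) (W.geomPrimaryTorsion 2) = ⊥)
    (hfix' : FixedPoints.addSubgroup (κ.layerSubgroup (n + 1)) (W'.geomPrimaryTorsion 2) = ⊥) :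
    Nat.card ↥((W.selmerLayer κ (n + 1)).comap (W.resOfLe 2 (κ.layerSubgroup_antitone (Nat.le_succ n)))) *
        Nat.card ↥((W'.selmerLayer κ (n + 1)).comap (W'.resOfLe 2 (κ.layerSubgroup_antitone (Nat.le_succ n)))) ∣
      Nat.card (W.selmerLayer κ (n + 1)) *
        Nat.card ↥(W.selmerLayer κ (n + 1) ⊓ (W.conjH1 2 (κ.layerSubgroup (n + 1)) (γ ^ 2 ^ n) + AddMonoidHom.id (W.subgroupH1 2 (κ.layerSubgroup (n + 1)))).ker ⊓ AddSubgroup.torsionBy (W.subgroupH1 2 (κ.layerSubgroup (n + 1))) 2) := by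
  rw [natCard_selmerLayer_succ_eq_natCard_comap_mul W κ n hfix hγ, ← natCard_normKer_eq_natCard_twist_comap W W' κ n Ψ hγ hΨsel hΨg hfix', mul_assoc]
  exact mul_dvd_mul_left _ (natCard_normKer_dvd_mul W κ n)

/-- ★★ Seed cell (`E(K)[2] = 0`, `E′[2^∞]^{Gal(K̄/K_{n+1})} = 0`), EVERY Pontryagin-dual datum and layer: **`g_n ∣ #Sel♯_n(E′) · #ker g_{n+1}`** and **`#Sel♯_n(E′) ∣ g_n · #M_{n+1}[2]`** —
the growth number `g_n = #(ω_nX/ω_{n+1}X)` of `X(E/K_∞)` (gen 56/57) is the relaxed `2^∞`-Selmer group of the twist one layer down, up to Greenberg's control kernel and the `2`-torsion of the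
minus part. [cite: GreenbergLNM1716, §1 pp. 60–65, §3 pp. 85–90, §4 Lemma 4.3] [cite: Mazur1972, §6] [cite: DokchitserDokchitserAnnals2010, Lemma 4.14 (proof)] -/
theorem growth_dvd_natCard_comap_mul_kerG_and_dvd [W.IsElliptic] (hK : ∀ P : W.toAffine.Point, 2 • P = 0 → P = 0) (hγ : κ.IsTopGenerator γ)
    (hΨsel : ∀ x, x ∈ W'.selmerLayer κ (n + 1) ↔ Ψ x ∈ W.selmerLayer κ (n + 1))
    (hΨg : ∀ x, Ψ (W'.conjH1 2 (κ.layerSubgroup (n + 1)) (γ ^ 2 ^ n) x) = -(W.conjH1 2 (κ.layerSubgroup (n + 1)) (γ ^ 2 ^ n) (Ψ x)))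
    (hfix' : FixedPoints.addSubgroup (κ.layerSubgroup (n + 1)) (W'.geomPrimaryTorsion 2) = ⊥) (D : W.SelmerDualData κ γ) :
    Nat.card (↥(Ideal.span {((1 + PowerSeries.X : PowerSeries ℤ_[2]) ^ (2 ^ n) - 1 : IwasawaAlgebra 2)} • ⊤ : Submodule (IwasawaAlgebra 2) D.X) ⧸
        (Ideal.span {(((Polynomial.cyclotomic (2 ^ (n + 1)) ℤ_[2]).comp (Polynomial.X + 1) : ℤ_[2][X]) : IwasawaAlgebra 2)} • ⊤ :
          Submodule (IwasawaAlgebra 2) ↥(Ideal.span {((1 + PowerSeries.X : PowerSeries ℤ_[2]) ^ (2 ^ n) - 1 : IwasawaAlgebra 2)} • ⊤ :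
            Submodule (IwasawaAlgebra 2) D.X))) ∣
        Nat.card ↥((W'.selmerLayer κ (n + 1)).comap (W'.resOfLe 2 (κ.layerSubgroup_antitone (Nat.le_succ n)))) * Nat.card (W.KerG κ (n + 1)) ∧
      Nat.card ↥((W'.selmerLayer κ (n + 1)).comap (W'.resOfLe 2 (κ.layerSubgroup_antitone (Nat.le_succ n)))) ∣
        Nat.card (↥(Ideal.span {((1 + PowerSeries.X : PowerSeries ℤ_[2]) ^ (2 ^ n) - 1 : IwasawaAlgebra 2)} • ⊤ : Submodule (IwasawaAlgebra 2) D.X) ⧸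
        (Ideal.span {(((Polynomial.cyclotomic (2 ^ (n + 1)) ℤ_[2]).comp (Polynomial.X + 1) : ℤ_[2][X]) : IwasawaAlgebra 2)} • ⊤ :
          Submodule (IwasawaAlgebra 2) ↥(Ideal.span {((1 + PowerSeries.X : PowerSeries ℤ_[2]) ^ (2 ^ n) - 1 : IwasawaAlgebra 2)} • ⊤ :
            Submodule (IwasawaAlgebra 2) D.X))) *
          Nat.card ↥(W.selmerLayer κ (n + 1) ⊓ (W.conjH1 2 (κ.layerSubgroup (n + 1)) (γ ^ 2 ^ n) + AddMonoidHom.id (W.subgroupH1 2 (κ.layerSubgroup (n + 1)))).ker ⊓ AddSubgroup.torsionBy (W.subgroupH1 2 (κ.layerSubgroup (n + 1))) 2) := by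
  rw [← natCard_normKer_eq_natCard_twist_comap W W' κ n Ψ hγ hΨsel hΨg hfix']
  obtain ⟨h1, h2⟩ := natCard_map_selmerLayer_dvd_growth_dvd W κ hK hγ D n
  exact ⟨h2.trans (mul_dvd_mul_right (natCard_map_dvd_natCard_normKer W κ hγ n) _),
    (natCard_normKer_dvd_mul W κ n).trans (mul_dvd_mul_right h1 _)⟩

end Product

/-! ## §2 The first layer for the quadratic twist (any number field) -/

section Quadratic

variable {K : Type u} [Field K] [NumberField K] (W : WeierstrassCurve K) [W.IsElliptic] (κ : ZpExtension K 2) {γ : Field.absoluteGaloisGroup K}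
  {d : K} {θ : AlgebraicClosure K}

/-- ★★★ **`#Sel_{2^∞}(W/K_1) ∣ #Sel♯_0(W) · #Sel♯_0(W^{(d)})`** and **`#Sel♯_0(W)·#Sel♯_0(W^{(d)}) ∣ #Sel_{2^∞}(W/K_1)·#M_1[2]`** (`K_1 = K(√d)` the first layer, `W(K)[2] = 0`).
[cite: DokchitserDokchitserAnnals2010, Lemma 4.14 (proof)] [cite: GreenbergLNM1716, §4 p. 107] -/
theorem natCard_selmerLayer_one_dvd_and_dvd_quadraticTwist (hK : ∀ P : W.toAffine.Point, 2 • P = 0 → P = 0) (hγ : κ.IsTopGenerator γ)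
    (hd : d ≠ 0) (hθ : θ ^ 2 = algebraMap K (AlgebraicClosure K) d)
    (hθ1 : ∀ σ : Field.absoluteGaloisGroup K, σ ∈ κ.layerSubgroup 1 → σ • θ = θ) (hγθ : γ • θ = -θ) :
    Nat.card (W.selmerLayer κ 1) ∣ Nat.card ↥((W.selmerLayer κ 1).comap (W.resOfLe 2 (κ.layerSubgroup_antitone (Nat.le_succ 0)))) * Nat.card ↥(((W.quadraticTwist d).selmerLayer κ 1).comap ((W.quadraticTwist d).resOfLe 2 (κ.layerSubgroup_antitone (Nat.le_succ 0)))) ∧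
      Nat.card ↥((W.selmerLayer κ 1).comap (W.resOfLe 2 (κ.layerSubgroup_antitone (Nat.le_succ 0)))) * Nat.card ↥(((W.quadraticTwist d).selmerLayer κ 1).comap ((W.quadraticTwist d).resOfLe 2 (κ.layerSubgroup_antitone (Nat.le_succ 0)))) ∣
        Nat.card (W.selmerLayer κ 1) * Nat.card ↥(W.selmerLayer κ 1 ⊓ (W.conjH1 2 (κ.layerSubgroup 1) γ + AddMonoidHom.id (W.subgroupH1 2 (κ.layerSubgroup 1))).ker ⊓ AddSubgroup.torsionBy (W.subgroupH1 2 (κ.layerSubgroup 1)) 2) := by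
  obtain ⟨Ψ, hΨsel, hΨγ⟩ := AlignedTransportAtTwoHalfDescentLayerIndexGrowthFiniteTwistQuadratic.exists_twistDatum W κ hd hθ hθ1 hγθ
  have hΨg : ∀ x, Ψ ((W.quadraticTwist d).conjH1 2 (κ.layerSubgroup (0 + 1)) (γ ^ 2 ^ 0) x) =
      -(W.conjH1 2 (κ.layerSubgroup (0 + 1)) (γ ^ 2 ^ 0) (Ψ x)) := by
    simpa only [pow_zero, pow_one] using hΨγ
  have hfix : FixedPoints.addSubgroup (κ.layerSubgroup (0 + 1)) (W.geomPrimaryTorsion 2) = ⊥ := fixedPoints_layerSubgroup_eq_bot W κ hK (0 + 1)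
  have hfix' : FixedPoints.addSubgroup (κ.layerSubgroup (0 + 1)) ((W.quadraticTwist d).geomPrimaryTorsion 2) = ⊥ :=
    fixedPoints_eq_bot_of_forall (W.quadraticTwist d) _ (AlignedTransportAtTwoHalfDescentLayerIndexGrowthFiniteTwistQuadratic.forall_fixed_quadraticTwist_eq_zero W κ hK hd hθ hθ1)
  have h1 := natCard_selmerLayer_succ_dvd_natCard_comap_mul_comap W (W.quadraticTwist d) κ 0 Ψ hγ hΨsel hΨg hfix hfix'
  have h2 := natCard_comap_mul_comap_dvd W (W.quadraticTwist d) κ 0 Ψ hγ hΨsel hΨg hfix hfix'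
  exact ⟨by simpa only [pow_zero, pow_one] using h1, by simpa only [pow_zero, pow_one] using h2⟩

end Quadratic

/-! ## §3 `K = ℚ`, `κ` cyclotomic: `ℚ_1 = ℚ(√2)` -/

section Rat

variable (W : WeierstrassCurve ℚ) [W.IsElliptic] (κ : ZpExtension ℚ 2) {γ : Field.absoluteGaloisGroup ℚ}

/-- ★★★ `K = ℚ`, `κ` cyclotomic, `E` elliptic without a rational `2`-torsion abscissa: **`#Sel_{2^∞}(E/ℚ(√2)) ∣ #Sel♯_0(E) · #Sel♯_0(E^{(2)})`** and
**`#Sel♯_0(E) · #Sel♯_0(E^{(2)}) ∣ #Sel_{2^∞}(E/ℚ(√2)) · #M_1[2]`** (`Sel♯_0(·) = {η ∈ H¹(ℚ, ·[2^∞]) : res η ∈ Sel_{2^∞}(·/ℚ(√2))}`). [cite: DokchitserDokchitserAnnals2010, Lemma 4.14 (proof)]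
[cite: Washington1997, §13.1] -/
theorem natCard_selmerLayer_one_dvd_and_dvd_quadraticTwist_two (hκ : κ.IsCyclotomic) (hγ : κ.IsTopGenerator γ) (ht : ∀ x : ℚ, ¬ HasRationalTwoTorsionX W x) :
    Nat.card (W.selmerLayer κ 1) ∣ Nat.card ↥((W.selmerLayer κ 1).comap (W.resOfLe 2 (κ.layerSubgroup_antitone (Nat.le_succ 0)))) * Nat.card ↥(((W.quadraticTwist 2).selmerLayer κ 1).comap ((W.quadraticTwist 2).resOfLe 2 (κ.layerSubgroup_antitone (Nat.le_succ 0)))) ∧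
      Nat.card ↥((W.selmerLayer κ 1).comap (W.resOfLe 2 (κ.layerSubgroup_antitone (Nat.le_succ 0)))) * Nat.card ↥(((W.quadraticTwist 2).selmerLayer κ 1).comap ((W.quadraticTwist 2).resOfLe 2 (κ.layerSubgroup_antitone (Nat.le_succ 0)))) ∣
        Nat.card (W.selmerLayer κ 1) * Nat.card ↥(W.selmerLayer κ 1 ⊓ (W.conjH1 2 (κ.layerSubgroup 1) γ + AddMonoidHom.id (W.subgroupH1 2 (κ.layerSubgroup 1))).ker ⊓ AddSubgroup.torsionBy (W.subgroupH1 2 (κ.layerSubgroup 1)) 2) := by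
  obtain ⟨θ, hθ, hθ1, hγθ⟩ := AlignedTransportAtTwoHalfDescentLayerIndexGrowthFiniteTwistQuadratic.exists_sqrt_two_datum κ hκ hγ
  exact natCard_selmerLayer_one_dvd_and_dvd_quadraticTwist W κ (forall_two_nsmul_eq_zero W ht) hγ two_ne_zero hθ hθ1 hγθ

/-- ★★ `K = ℚ`, `κ` cyclotomic with topological generator `γ`, `E` elliptic without a rational `2`-torsion abscissa, `D` ANY Pontryagin-dual datum:
**`g_0 ∣ #Sel♯_0(E^{(2)}) · #ker g_1`** and **`#Sel♯_0(E^{(2)}) ∣ g_0 · #M_1[2]`**, `g_0 = #(TX/ω_1X)` the first growth number of `X(E/ℚ_∞)` (`= #Sel_∞^{Γ_1}/#Sel_∞^{Γ}`, gen 56) — read on the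
`ℚ(√2)`-relaxed `2^∞`-Selmer group of the twist `E^{(2)}` over `ℚ`. Nothing numerical is asserted. [cite: GreenbergLNM1716, §1 pp. 60–65, §3 pp. 85–90, §4 Lemma 4.3] [cite: Mazur1972, §6]
[cite: Washington1997, §13.1] -/
theorem growth_zero_dvd_and_dvd_quadraticTwist_two (hκ : κ.IsCyclotomic) (hγ : κ.IsTopGenerator γ) (ht : ∀ x : ℚ, ¬ HasRationalTwoTorsionX W x) (D : W.SelmerDualData κ γ) :
    Nat.card (↥(Ideal.span {((1 + PowerSeries.X : PowerSeries ℤ_[2]) ^ (2 ^ 0) - 1 : IwasawaAlgebra 2)} • ⊤ : Submodule (IwasawaAlgebra 2) D.X) ⧸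
        (Ideal.span {(((Polynomial.cyclotomic (2 ^ (0 + 1)) ℤ_[2]).comp (Polynomial.X + 1) : ℤ_[2][X]) : IwasawaAlgebra 2)} • ⊤ :
          Submodule (IwasawaAlgebra 2) ↥(Ideal.span {((1 + PowerSeries.X : PowerSeries ℤ_[2]) ^ (2 ^ 0) - 1 : IwasawaAlgebra 2)} • ⊤ :
            Submodule (IwasawaAlgebra 2) D.X))) ∣
        Nat.card ↥(((W.quadraticTwist 2).selmerLayer κ 1).comap ((W.quadraticTwist 2).resOfLe 2 (κ.layerSubgroup_antitone (Nat.le_succ 0)))) * Nat.card (W.KerG κ 1) ∧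
      Nat.card ↥(((W.quadraticTwist 2).selmerLayer κ 1).comap ((W.quadraticTwist 2).resOfLe 2 (κ.layerSubgroup_antitone (Nat.le_succ 0)))) ∣
        Nat.card (↥(Ideal.span {((1 + PowerSeries.X : PowerSeries ℤ_[2]) ^ (2 ^ 0) - 1 : IwasawaAlgebra 2)} • ⊤ : Submodule (IwasawaAlgebra 2) D.X) ⧸
        (Ideal.span {(((Polynomial.cyclotomic (2 ^ (0 + 1)) ℤ_[2]).comp (Polynomial.X + 1) : ℤ_[2][X]) : IwasawaAlgebra 2)} • ⊤ :
          Submodule (IwasawaAlgebra 2) ↥(Ideal.span {((1 + PowerSeries.X : PowerSeries ℤ_[2]) ^ (2 ^ 0) - 1 : IwasawaAlgebra 2)} • ⊤ :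
            Submodule (IwasawaAlgebra 2) D.X))) *
          Nat.card ↥(W.selmerLayer κ (0 + 1) ⊓ (W.conjH1 2 (κ.layerSubgroup (0 + 1)) (γ ^ 2 ^ 0) + AddMonoidHom.id (W.subgroupH1 2 (κ.layerSubgroup (0 + 1)))).ker ⊓ AddSubgroup.torsionBy (W.subgroupH1 2 (κ.layerSubgroup (0 + 1))) 2) := by
  obtain ⟨θ, hθ, hθ1, hγθ⟩ := AlignedTransportAtTwoHalfDescentLayerIndexGrowthFiniteTwistQuadratic.exists_sqrt_two_datum κ hκ hγ
  obtain ⟨Ψ, hΨsel, hΨγ⟩ := AlignedTransportAtTwoHalfDescentLayerIndexGrowthFiniteTwistQuadratic.exists_twistDatum W κ two_ne_zero hθ hθ1 hγθ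
  have hΨg : ∀ x, Ψ ((W.quadraticTwist 2).conjH1 2 (κ.layerSubgroup (0 + 1)) (γ ^ 2 ^ 0) x) =
      -(W.conjH1 2 (κ.layerSubgroup (0 + 1)) (γ ^ 2 ^ 0) (Ψ x)) := by
    simpa only [pow_zero, pow_one] using hΨγ
  have hfix' : FixedPoints.addSubgroup (κ.layerSubgroup (0 + 1)) ((W.quadraticTwist 2).geomPrimaryTorsion 2) = ⊥ :=
    fixedPoints_eq_bot_of_forall (W.quadraticTwist 2) _
      (AlignedTransportAtTwoHalfDescentLayerIndexGrowthFiniteTwistQuadratic.forall_fixed_quadraticTwist_eq_zero W κ (forall_two_nsmul_eq_zero W ht)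
        two_ne_zero hθ hθ1)
  exact growth_dvd_natCard_comap_mul_kerG_and_dvd W (W.quadraticTwist 2) κ 0 Ψ (forall_two_nsmul_eq_zero W ht) hγ hΨsel hΨg hfix' D

end Rat

end Summit.BirchSwinnertonDyer.BirchSwinnertonDyer.Theorems.AlignedTransportAtTwoHalfDescentLayerIndexGrowthFiniteTwistProduct

end
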